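import Summits.QuantumFields.BalabanUV.Beta.D1BFx.DressedVertexSplit
import Summits.QuantumFields.BalabanUV.Beta.D1BFx.ColumnGaugeGenerator

/-!
# `BalabanUV.Beta.D1BFx.ColumnGaugeNativeFirstOrder` — road «BF-x», binder row D1, PART 24 (chart of record (α′), an2 R-D1-g44-2):
# THE FIRST-ORDER HALF OF THE COLUMN-GAUGE INSTANCE FOR THE NATIVE SPINE AT LEVEL 0 — the bm-dressed chain-rule vertex IS the straight
# one plus a commutator with the road kernel's `RelInv` partner `bhKAt` (leaf-01's `DressedVertexSplit` ∘ `ColumnGaugeGenerator` §4, composed)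

HONEST DEPENDENCY (cell records, verbatim): «continuum YM on T⁴ ⇐ BetaPertH ∧ nine spine estimates (0/9 proved); BetaPertH ⇐ (D1) ∧ (D4) ∧
CAP+tail; G-an2-4 gates asym, D1 and NE2/3/4.»  HONEST FRAMING (cell contract, verbatim): «discharging `BetaPertH` makes Bałaban's UV stability
UNCONDITIONAL — a real constructive-QFT result; it is NOT the continuum limit and NOT the Clay problem.»  THIS MODULE DISCHARGES NO binder of
row D1 and NO estimate of Bałaban's: one [our object] identity between OUR kernels, composed BY NAME from leaf-01 g29's
`DressedVertexSplit.vertexOfK_coDressKBmAt_eq_sub` (p353423 ✓), `ColumnGaugeGenerator.wsum_divV_S0NAt_eq_comm` (p354471 ✓), g53's column envelope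
`PackedColumnEnvelope.abs_colH_KInvStep_zero_le` and an2's `SpineRootedS0N.locStencil_S0NAt`.  No `def`, no `def … : Prop`, nothing cited, 0 sorry.
NOT D1, NOT BetaPertH, NOT continuum, NOT Clay.

ABSOLUTE RULE (cell charter, verbatim): «No internally-minted statement may enter as a cited fact. Every hypothesis is either kernel-proved in this
package or a verbatim quotation of a PUBLISHED theorem with page reference.»

THE IDENTITY.  For the native spine `S0NAt d Lc ρ cE cVH cΛ` at an in-block root `ρ = toSite r`, on the hR normalisation hyperplane
`2·cVH = −cE·Lc^{d+1}` (the road's pins lie on it), for every coarse bond `(μ, y)`: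
`vertexOfK (coDressKBmAt ρ Lc (KInvStep Lc 0)) Lc S0NAt μ y = vertexOfK (KInvStep Lc 0) Lc S0NAt μ y + (Λ μ y ∘ bhKAt − bhKAt ∘ Λ μ y)`,
`Λ μ y := diagK (z b ↦ (cE∕2)·χ_{μ,y} (legSite ρ z b))`, `χ_{μ,y} := bmGaugeAt ρ (colH (KInvStep Lc 0) Lc μ y) Lc` — i.e. `V^{bm} = V^{smooth} + G` with
`G μ y = Λ μ y∘𝕄₀ − 𝕄₀∘Λ μ y`, `𝕄₀ = bhKAt` = the `RelInv` partner of the road kernel (`BorderedHessianRooted.relInv_coDressKBmAt_KInvStep_zero_bhKAt`), and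
`Λ μ y ∘ axEc = axEc ∘ Λ μ y` (`ColumnGaugeGenerator.comp_generator_axEc_comm`) — the first-order IDENTITY letters of `ColumnGaugeInvariance.hessKer_columnGauge_of_relInv`
(p353709 ✓) for this spine, on the hyperplane; the routine side conditions (`Spr`: `spr_G₀bm`, an2's `spr_bhKAt` ∕ `spr_axEc`; `Loc (Λ μ y)` in the
SHAPE of §2 `loc_diagK_weight_legSite` — a diagonal kernel with an exponentially decaying symbol `χ ∘ legSite ρ` is `Loc`; the decay of `χ_{μ,y}` itself is leaf-01's
`DressedVertexSplit.abs_bmGaugeAt_weight_le`) are displayed, not consumed, here.  (Second order — the `Wmix + Wgg + Nr` identification of the spine's `W` — is the successor's FILE 2;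
the COMB literal carries one extra displayed `Dsh`-border word, `ColumnGaugeCombLetter` ∕ F-g23-3.)  Unit `b2b-balaban-beta-d1-p2` gen 23; no existing file touched.
-/

namespace Summit.QuantumFields.BalabanUV.Beta.D1BFx.ColumnGaugeNativeFirstOrder

open Literature.MathematicalPhysics.QuantumFieldTheory
open Literature.MathematicalPhysics.QuantumFieldTheory.LatticeForm (quo)
open Literature.MathematicalPhysics.QuantumFieldTheory.Balaban1983to89
open Literature.MathematicalPhysics.QuantumFieldTheory.Balaban1983to89.Beta
open B4ContourShift (supNorm)
open ExpKernelCalculus (MKer comp l1_sub_triangle l1_sub_symm)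
open B12Sec2to5 (l1 l1_nonneg)
open Summit.QuantumFields.BalabanUV.Beta.TameKernelCalculus (Loc)
open AffineAveraging (Site box toSite)
open OneStepResolventKernel (Fib wsum LocStencil)
open OneStepKernelFamily (colH vertexOfK KInvStep)
open KernelWard (divV)
open Summit.QuantumFields.BalabanUV.Beta.AxialDressingRooted (coDressKBmAt)
open Summit.QuantumFields.BalabanUV.Beta.AxialProjectorBlockMean (bmGaugeAt)
open Summit.QuantumFields.BalabanUV.Beta.BorderedHessian (diagK bhKAt)
open Summit.QuantumFields.BalabanUV.Beta.AveragingWardRootedStencils (legSite)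
open Summit.QuantumFields.BalabanUV.Beta.SpineRooted (S0NAt locStencil_S0NAt)
open Summit.QuantumFields.BalabanUV.Beta.D1BFx.PackedColumnEnvelope (abs_colH_KInvStep_zero_le)
open Summit.QuantumFields.BalabanUV.Beta.D1BFx.DressedVertexSplit (vertexOfK_coDressKBmAt_eq_sub)
open Summit.QuantumFields.BalabanUV.Beta.D1BFx.ColumnGaugeGenerator (wsum_divV_S0NAt_eq_comm)
open B5Hk163Strip (kappa163 kappa163_pos)
open B5Hk163Decay (MG163)
open B4TorusKernel (periodConst)

noncomputable section

variable {d : ℕ} {Lc : ℕ} [NeZero Lc]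

/-- **THE bm-DRESSED VERTEX OF THE NATIVE SPINE = THE STRAIGHT ONE + A COMMUTATOR WITH `bhKAt`** [our object] (the first-order half of the column-gauge
instance for the native spine at level 0; the hR hyperplane `2·cVH = −cE·Lc^{d+1}` is the only non-structural hypothesis). -/
theorem vertexOfK_G0bm_S0NAt_eq_add_comm (hLc : 1 ≤ Lc) {r : Fin (d + 1) → ℕ} (hr : r ∈ box (d + 1) Lc) {cE cVH : ℝ} (cΛ : ℝ)
    (hn : 2 * cVH = -(cE * (Lc : ℝ) ^ (d + 1))) (μ : Fin (d + 1)) (y : Site (d + 1)) :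
    vertexOfK (coDressKBmAt (toSite r) Lc (KInvStep (d := d) Lc 0)) Lc (S0NAt d Lc (toSite r) cE cVH cΛ) μ y
      = vertexOfK (KInvStep (d := d) Lc 0) Lc (S0NAt d Lc (toSite r) cE cVH cΛ) μ y
        + (comp (diagK (fun z b => cE / 2 * bmGaugeAt (toSite r) (colH (KInvStep (d := d) Lc 0) Lc μ y) Lc (legSite (toSite r) z b)))
              (bhKAt d (toSite r) Lc)
            - comp (bhKAt d (toSite r) Lc)
              (diagK (fun z b => cE / 2 * bmGaugeAt (toSite r) (colH (KInvStep (d := d) Lc 0) Lc μ y) Lc (legSite (toSite r) z b)))) := by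
  obtain ⟨Cs, δs, hδs, hS⟩ := locStencil_S0NAt (d := d) hLc hr cE cVH cΛ
  -- g53's block envelope of the straight column, with its sign read off the bound itself
  have hK : ∀ (κ : Fin (d + 1)) (u : Site (d + 1)), |colH (KInvStep (d := d) Lc 0) Lc μ y κ u|
      ≤ ((Lc : ℝ) ^ (d + 2))⁻¹ * (MG163 (d + 1) * periodConst (kappa163 (d + 1)) d)
          * Real.exp (-(kappa163 (d + 1) / ((d : ℝ) + 1) * supNorm (quo Lc u - y))) :=
    fun κ u => abs_colH_KInvStep_zero_le (d := d) (N := Lc) hLc μ y κ u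
  have hM : 0 ≤ ((Lc : ℝ) ^ (d + 2))⁻¹ * (MG163 (d + 1) * periodConst (kappa163 (d + 1)) d) :=
    (mul_nonneg_iff_of_pos_right (Real.exp_pos _)).1 ((abs_nonneg _).trans (hK 0 0))
  have hc : 0 < kappa163 (d + 1) / ((d : ℝ) + 1) := div_pos (kappa163_pos (d + 1)) (by positivity)
  rw [vertexOfK_coDressKBmAt_eq_sub hLc hr _ hS hδs μ y hM hc hK,
    show wsum (bmGaugeAt (toSite r) (colH (KInvStep (d := d) Lc 0) Lc μ y) Lc) (divV (S0NAt d Lc (toSite r) cE cVH cΛ))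
      = wsum (bmGaugeAt (toSite r) (colH (KInvStep (d := d) Lc 0) Lc μ y) Lc) (fun u => divV (S0NAt d Lc (toSite r) cE cVH cΛ) u) from rfl,
    wsum_divV_S0NAt_eq_comm hLc hr cΛ hn]
  abel


/-! ## §2 The side condition `Loc (Λ μ y)`: a diagonal kernel with an exponentially decaying symbol is localised -/

omit [NeZero Lc] in
/-- [folklore] A diagonal kernel whose symbol decays from `p` is bi-localised at `(p, p)` (half rate). -/
theorem biLoc_diagK_of_decay {g : (Fin (d + 1) → ℤ) → Fib d → ℝ} {C δ : ℝ} {p : Site (d + 1)} (hC : 0 ≤ C)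
    (hg : ∀ z b, |g z b| ≤ C * Real.exp (-δ * l1 (z - p))) :
    ExpKernelCalculus.BiLoc (diagK g) p p C (δ / 2) := by
  classical
  intro x y a b
  rw [Summit.QuantumFields.BalabanUV.Beta.BorderedHessian.diagK_apply]
  split_ifs with h
  · obtain ⟨rfl, rfl⟩ := h
    refine (hg x a).trans (le_of_eq ?_)
    congr 1
    congr 1
    ring
  · rw [abs_zero]; positivity

omit [NeZero Lc] in
/-- [folklore] **`Loc` OF THE COLUMN-GAUGE GENERATOR's SHAPE**: if the weight decays, `|χ u| ≤ C·e^{−δ|u − p|₁}` with `δ > 0` (leaf-01's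
`DressedVertexSplit.abs_bmGaugeAt_weight_le` gives this for `χ = bmGaugeAt ρ (colH K N μ y) N` from a column block envelope), then for every root `ρ` and scalar `ξ`
the diagonal generator `diagK (z b ↦ ξ·χ (legSite ρ z b))` is `Loc` (multiplier legs act at `z + ρ`: one triangle inequality, constant `|ξ|·C·e^{δ|ρ|₁}`). -/
theorem loc_diagK_weight_legSite {χ : Site (d + 1) → ℝ} {C δ : ℝ} {p : Site (d + 1)} (hC : 0 ≤ C) (hδ : 0 < δ)
    (hχ : ∀ u, |χ u| ≤ C * Real.exp (-δ * l1 (u - p))) (ρ : Site (d + 1)) (ξ : ℝ) :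
    Loc (diagK (fun z b => ξ * χ (legSite ρ z b))) := by
  refine ⟨p, p, |ξ| * (C * Real.exp (δ * l1 ρ)), δ / 2, by positivity, biLoc_diagK_of_decay (by positivity) fun z b => ?_⟩
  rw [abs_mul, mul_assoc]
  refine mul_le_mul_of_nonneg_left ?_ (abs_nonneg _)
  -- `|χ w| ≤ C e^{δ|ρ|₁} e^{−δ|z − p|₁}` whenever the action site `w` is within `|ρ|₁` of `z`
  have hle : ∀ w : Site (d + 1), l1 (w - z) ≤ l1 ρ → |χ w| ≤ C * Real.exp (δ * l1 ρ) * Real.exp (-δ * l1 (z - p)) := by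
    intro w hw
    refine (hχ w).trans ?_
    rw [mul_assoc, ← Real.exp_add]
    refine mul_le_mul_of_nonneg_left (Real.exp_le_exp.2 ?_) hC
    have h1 : l1 (z - p) ≤ l1 (z - w) + l1 (w - p) := l1_sub_triangle z w p
    rw [l1_sub_symm z w] at h1
    nlinarith [hδ.le, hw, h1, l1_nonneg (w - p)]
  have h0 : l1 (z - z) ≤ l1 ρ := by
    rw [sub_self]
    have : l1 (0 : Site (d + 1)) = 0 := by simp [B12Sec2to5.l1]
    rw [this]; exact l1_nonneg ρ
  rcases b with α | μ
  · -- fluctuation leg: acts at `z`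
    simpa [legSite] using hle z h0
  · -- multiplier leg: acts at `z + ρ`
    simpa [legSite] using hle (z + ρ) (by rw [add_sub_cancel_left])

end

end Summit.QuantumFields.BalabanUV.Beta.D1BFx.ColumnGaugeNativeFirstOrder
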